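import Mathlib
import HarnessLib
import Summits.HubbardSuperconductivity.HubbardSuperconductivity.Theorems.KLProgrammeKLRegimeCountertermGridReading
import Summits.HubbardSuperconductivity.HubbardSuperconductivity.Theorems.KLProgrammeKLRegimeSplitSymInterp

/-!
# Route `KLProgramme` — child `KLRegimeCounterterm` (V9+): the GRID IDENTITY, part A — `D₄`-INVARIANCE OF THE LOCAL-PART PROFILE
# `θ ↦ ν_n(K)(θ)` (and of `θ ↦ K(k_F(θ))`) for every frame `K : TrigPolyC4v`, and the values of such profiles at the polar angles of
# `D₄`-related vectors (seat hubbard-kl-k3c3-p3; Δ18 consumer side; part B = `…CountertermGridIdentity`)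

The one-volume construction of child 2 (`CtOneVolume`) controls frames (`klTwoLegPolyG`, `klFrameProjG`, the pieces) as POLYNOMIALS; the
renormalisation condition is read on the PROFILE `θ ↦ ν_n(K)(θ) = klLocalPart … K n θ`.  The bridge is p1b's interpolation theorem
`symInterp_eval_latticeMomentum` (exact at lattice momenta for `D₄`-symmetric data); this module supplies the `D₄`-symmetry of the data
`k ↦ mean f + χ_flat(k)·(f(momentumAngle L k) − mean f)` for every `2π`-periodic profile `f` invariant under `θ ↦ θ + π`, `θ ↦ −θ`,
`θ ↦ π/2 − θ`, and proves that the local part of EVERY frame `K : TrigPolyC4v` (no admissibility needed) is such a profile: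

* §1 `dir`, the root set and the canonical Fermi radius under `θ ↦ −θ`, `θ ↦ π/2 − θ` (p4's `…_add_pi` pattern): `klFermiPoint_add_pi`,
  `klFermiPoint_neg`, `klFermiPoint_pi_div_two_sub`;
* §2 the profiles `θ ↦ ν_n(K)(θ)` and `θ ↦ K(k_F(θ))`: `2π`-periodic and `D₄`-invariant (`klLocalPart_add_pi/_neg/_pi_div_two_sub`, …),
  and their values at polar angles of `D₄`-related vectors (`…_polarAngle_neg/_conj/_negConj/_swap`);
* (part B, `…CountertermGridIdentity`) the lattice data are `D₄`-symmetric ⇒ the grid identities.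

Proofs only; nothing is asserted about the Hubbard model.  References: BGM 2006 [arXiv:cond-mat/0507686] §2.4 (central symmetry of the
curve), §2.5; HOME/hubbard-kl-k3c3-p3/DEFECT-ANGULAR.md §4–§5.
-/

noncomputable section

namespace Summit.HubbardSuperconductivity.HubbardSuperconductivity.Theorems.KLRegimeSplit

set_option linter.dupNamespace false -- summit = problem name (single-conjunct summit), D-0017

open Real Set Complex
open Literature.MathematicalPhysics.QuantumLattice Literature.Probability.LatticeModels
open Summit.HubbardSuperconductivity.HubbardSuperconductivity.Theorems.KLProgrammeLegKernels
open Summit.HubbardSuperconductivity.HubbardSuperconductivity.Theorems.PerturbedFermiCurve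

/-! ## §1 The ray direction, the root set and the canonical radius under the reflections of `D₄` -/

/-- `dir (−θ) = (cos θ, −sin θ)`. -/
theorem dir_neg (θ : ℝ) : dir (-θ) = ![Real.cos θ, -Real.sin θ] := by
  ext i; fin_cases i <;> simp [dir, Real.cos_neg, Real.sin_neg]

/-- `dir (π/2 − θ) = (sin θ, cos θ)`. -/
theorem dir_pi_div_two_sub (θ : ℝ) : dir (π / 2 - θ) = ![Real.sin θ, Real.cos θ] := by
  ext i; fin_cases i <;> simp [dir, Real.cos_pi_div_two_sub, Real.sin_pi_div_two_sub]

/-- The sup norm of a plane vector is unchanged by negating the second coordinate. -/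
theorem norm_vec2_neg_snd (a b : ℝ) : ‖(![a, -b] : Fin 2 → ℝ)‖ = ‖(![a, b] : Fin 2 → ℝ)‖ := by
  apply le_antisymm
  · refine (pi_norm_le_iff_of_nonneg (norm_nonneg _)).2 fun i => ?_
    fin_cases i
    · simpa using norm_le_pi_norm (![a, b] : Fin 2 → ℝ) 0
    · simpa using norm_le_pi_norm (![a, b] : Fin 2 → ℝ) 1
  · refine (pi_norm_le_iff_of_nonneg (norm_nonneg _)).2 fun i => ?_
    fin_cases i
    · simpa using norm_le_pi_norm (![a, -b] : Fin 2 → ℝ) 0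
    · simpa using norm_le_pi_norm (![a, -b] : Fin 2 → ℝ) 1

/-- The sup norm of a plane vector is unchanged by swapping the coordinates. -/
theorem norm_vec2_swap (a b : ℝ) : ‖(![b, a] : Fin 2 → ℝ)‖ = ‖(![a, b] : Fin 2 → ℝ)‖ := by
  apply le_antisymm
  · refine (pi_norm_le_iff_of_nonneg (norm_nonneg _)).2 fun i => ?_
    fin_cases i
    · simpa using norm_le_pi_norm (![a, b] : Fin 2 → ℝ) 1
    · simpa using norm_le_pi_norm (![a, b] : Fin 2 → ℝ) 0
  · refine (pi_norm_le_iff_of_nonneg (norm_nonneg _)).2 fun i => ?_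
    fin_cases i
    · simpa using norm_le_pi_norm (![b, a] : Fin 2 → ℝ) 1
    · simpa using norm_le_pi_norm (![b, a] : Fin 2 → ℝ) 0

/-- `dir θ` in vector notation. -/
theorem dir_eq_vec (θ : ℝ) : dir θ = ![Real.cos θ, Real.sin θ] := by
  ext i; fin_cases i <;> simp [dir]

/-- `‖dir (−θ)‖ = ‖dir θ‖`. -/
theorem norm_dir_neg (θ : ℝ) : ‖dir (-θ)‖ = ‖dir θ‖ := by
  rw [dir_neg, dir_eq_vec, norm_vec2_neg_snd]

/-- `‖dir (π/2 − θ)‖ = ‖dir θ‖`. -/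
theorem norm_dir_pi_div_two_sub (θ : ℝ) : ‖dir (π / 2 - θ)‖ = ‖dir θ‖ := by
  rw [dir_pi_div_two_sub, dir_eq_vec, norm_vec2_swap]

/-- The free level function along rays is even in the angle. -/
theorem rayDispersion_neg_angle (θ t : ℝ) : rayDispersion (-θ, t) = rayDispersion (θ, t) := by
  simp [rayDispersion_eq, Real.cos_neg, Real.sin_neg]

/-- The free level function along rays is invariant under `θ ↦ π/2 − θ`. -/
theorem rayDispersion_pi_div_two_sub_angle (θ t : ℝ) : rayDispersion (π / 2 - θ, t) = rayDispersion (θ, t) := by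
  simp [rayDispersion_eq, Real.cos_pi_div_two_sub, Real.sin_pi_div_two_sub, add_comm]

/-- The scaled reflected direction is the reflection of the scaled direction. -/
theorem smul_dir_neg (t θ : ℝ) : t • dir (-θ) = ![(t • dir θ) 0, -(t • dir θ) 1] := by
  ext i; fin_cases i <;> simp [dir, Real.cos_neg, Real.sin_neg]

/-- The scaled swapped direction is the swap of the scaled direction. -/
theorem smul_dir_pi_div_two_sub (t θ : ℝ) : t • dir (π / 2 - θ) = ![(t • dir θ) 1, (t • dir θ) 0] := by
  ext i; fin_cases i <;> simp [dir, Real.cos_pi_div_two_sub, Real.sin_pi_div_two_sub]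

/-- **Axis symmetry of the root set** for a perturbation invariant under `k ↦ (k₀, −k₁)`: the Fermi points of `ε₀ + δ` on the rays `θ`
and `−θ` are the same. -/
theorem isBandFermiRadius_shifted_neg {δ : (Fin 2 → ℝ) → ℝ} (hrefl : ∀ k : Fin 2 → ℝ, δ ![k 0, -k 1] = δ k) (μ θ t : ℝ) :
    IsBandFermiRadius (μ - δ (t • dir (-θ))) (-θ) t ↔ IsBandFermiRadius (μ - δ (t • dir θ)) θ t := by
  simp only [IsBandFermiRadius, smul_dir_neg, hrefl, norm_dir_neg, rayDispersion_neg_angle]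

/-- **Diagonal symmetry of the root set** for a perturbation invariant under the swap `k ↦ (k₁, k₀)`: the Fermi points on the rays `θ` and
`π/2 − θ` are the same. -/
theorem isBandFermiRadius_shifted_pi_div_two_sub {δ : (Fin 2 → ℝ) → ℝ} (hswap : ∀ k : Fin 2 → ℝ, δ ![k 1, k 0] = δ k) (μ θ t : ℝ) :
    IsBandFermiRadius (μ - δ (t • dir (π / 2 - θ))) (π / 2 - θ) t ↔ IsBandFermiRadius (μ - δ (t • dir θ)) θ t := by
  simp only [IsBandFermiRadius, smul_dir_pi_div_two_sub, hswap, norm_dir_pi_div_two_sub, rayDispersion_pi_div_two_sub_angle]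

/-- The canonical perturbed radius is even in the angle (axis-symmetric perturbation). -/
theorem perturbedFermiRadius_neg {δ : (Fin 2 → ℝ) → ℝ} (hrefl : ∀ k : Fin 2 → ℝ, δ ![k 0, -k 1] = δ k) (μ θ : ℝ) :
    perturbedFermiRadius δ μ (-θ) = perturbedFermiRadius δ μ θ :=
  perturbedFermiRadius_congr fun t => isBandFermiRadius_shifted_neg hrefl μ θ t

/-- The canonical perturbed radius is invariant under `θ ↦ π/2 − θ` (swap-symmetric perturbation). -/
theorem perturbedFermiRadius_pi_div_two_sub {δ : (Fin 2 → ℝ) → ℝ} (hswap : ∀ k : Fin 2 → ℝ, δ ![k 1, k 0] = δ k) (μ θ : ℝ) :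
    perturbedFermiRadius δ μ (π / 2 - θ) = perturbedFermiRadius δ μ θ :=
  perturbedFermiRadius_congr fun t => isBandFermiRadius_shifted_pi_div_two_sub hswap μ θ t

/-- **The frame's Fermi point under `θ ↦ θ + π`**: central symmetry, for EVERY `K : TrigPolyC4v`. -/
theorem klFermiPoint_add_pi (μ : ℝ) (K : TrigPolyC4v) (θ : ℝ) : klFermiPoint μ K (θ + π) = -klFermiPoint μ K θ := by
  unfold klFermiPoint
  rw [perturbedFermiRadius_add_pi (fun k => by simp [TrigPolyC4v.eval_neg]) μ θ, dir_add_pi, smul_neg]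

/-- **The frame's Fermi point under `θ ↦ −θ`**: axis reflection. -/
theorem klFermiPoint_neg (μ : ℝ) (K : TrigPolyC4v) (θ : ℝ) :
    klFermiPoint μ K (-θ) = ![klFermiPoint μ K θ 0, -klFermiPoint μ K θ 1] := by
  unfold klFermiPoint
  rw [perturbedFermiRadius_neg (fun k => by simp [TrigPolyC4v.eval_reflect]) μ θ, smul_dir_neg]

/-- **The frame's Fermi point under `θ ↦ π/2 − θ`**: diagonal reflection. -/
theorem klFermiPoint_pi_div_two_sub (μ : ℝ) (K : TrigPolyC4v) (θ : ℝ) :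
    klFermiPoint μ K (π / 2 - θ) = ![klFermiPoint μ K θ 1, klFermiPoint μ K θ 0] := by
  unfold klFermiPoint
  rw [perturbedFermiRadius_pi_div_two_sub (fun k => by simp [TrigPolyC4v.eval_swap]) μ θ, smul_dir_pi_div_two_sub]

/-! ## §2 The profiles are `D₄`-invariant -/

section Model

variable {L M : ℕ} [NeZero L] [NeZero M]

/-- `ν_n(K)(θ + π) = ν_n(K)(θ)`. -/
theorem klLocalPart_add_pi (β U μ : ℝ) (K : TrigPolyC4v) (n : ℕ) (θ : ℝ) :
    klLocalPart L M β U μ K n (θ + π) = klLocalPart L M β U μ K n θ := by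
  unfold klLocalPart; rw [klFermiPoint_add_pi, TrigPolyC4v.eval_neg]

/-- `ν_n(K)(−θ) = ν_n(K)(θ)`. -/
theorem klLocalPart_neg (β U μ : ℝ) (K : TrigPolyC4v) (n : ℕ) (θ : ℝ) :
    klLocalPart L M β U μ K n (-θ) = klLocalPart L M β U μ K n θ := by
  unfold klLocalPart; rw [klFermiPoint_neg, TrigPolyC4v.eval_reflect]

/-- `ν_n(K)(π/2 − θ) = ν_n(K)(θ)`. -/
theorem klLocalPart_pi_div_two_sub (β U μ : ℝ) (K : TrigPolyC4v) (n : ℕ) (θ : ℝ) :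
    klLocalPart L M β U μ K n (π / 2 - θ) = klLocalPart L M β U μ K n θ := by
  unfold klLocalPart; rw [klFermiPoint_pi_div_two_sub, TrigPolyC4v.eval_swap]

end Model

/-- The frame read on its own curve, `θ ↦ K(k_F(θ))`, is `2π`-periodic. -/
theorem frameOnCurve_periodic (μ : ℝ) (K : TrigPolyC4v) :
    Function.Periodic (fun θ => K.eval (klFermiPoint μ K θ)) (2 * π) := fun θ => by
  simp only [klFermiPoint_periodic μ K θ]

/-- `K(k_F(θ + π)) = K(k_F(θ))`. -/
theorem frameOnCurve_add_pi (μ : ℝ) (K : TrigPolyC4v) (θ : ℝ) :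
    K.eval (klFermiPoint μ K (θ + π)) = K.eval (klFermiPoint μ K θ) := by
  rw [klFermiPoint_add_pi, TrigPolyC4v.eval_neg]

/-- `K(k_F(−θ)) = K(k_F(θ))`. -/
theorem frameOnCurve_neg (μ : ℝ) (K : TrigPolyC4v) (θ : ℝ) :
    K.eval (klFermiPoint μ K (-θ)) = K.eval (klFermiPoint μ K θ) := by
  rw [klFermiPoint_neg, TrigPolyC4v.eval_reflect]

/-- `K(k_F(π/2 − θ)) = K(k_F(θ))`. -/
theorem frameOnCurve_pi_div_two_sub (μ : ℝ) (K : TrigPolyC4v) (θ : ℝ) :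
    K.eval (klFermiPoint μ K (π / 2 - θ)) = K.eval (klFermiPoint μ K θ) := by
  rw [klFermiPoint_pi_div_two_sub, TrigPolyC4v.eval_swap]

/-! ### A `D₄`-invariant periodic profile takes equal values at the polar angles of `D₄`-related vectors -/

section Profile

variable {f : ℝ → ℝ} (hper : Function.Periodic f (2 * π)) (hpi : ∀ θ, f (θ + π) = f θ) (hneg : ∀ θ, f (-θ) = f θ)
  (hsw : ∀ θ, f (π / 2 - θ) = f θ)
include hper

/-- Equal angles (mod `2π`) give equal values of a `2π`-periodic profile. -/
theorem profile_eq_of_coe_angle_eq {θ₁ θ₂ : ℝ} (h : (θ₁ : Real.Angle) = θ₂) : f θ₁ = f θ₂ := by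
  obtain ⟨m, hm⟩ := Real.Angle.angle_eq_iff_two_pi_dvd_sub.mp h
  rw [show θ₁ = θ₂ + m * (2 * π) by linarith]
  exact hper.int_mul m θ₂

omit hper in
/-- `momToComplex` of the negated / reflected / swapped vector. -/
theorem momToComplex_neg_vec (c : Fin 2 → ℝ) : momToComplex (-c) = -momToComplex c := by
  apply Complex.ext <;> simp

omit hper in
/-- `momToComplex (c₀, −c₁) = conj`. -/
theorem momToComplex_reflect_vec (c : Fin 2 → ℝ) : momToComplex ![c 0, -c 1] = (starRingEnd ℂ) (momToComplex c) := by
  apply Complex.ext <;> simp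

omit hper in
/-- `momToComplex (−c₀, c₁) = −conj`. -/
theorem momToComplex_negReflect_vec (c : Fin 2 → ℝ) : momToComplex ![-c 0, c 1] = -(starRingEnd ℂ) (momToComplex c) := by
  apply Complex.ext <;> simp

omit hper in
/-- `momToComplex (c₁, c₀) = I · conj`. -/
theorem momToComplex_swap_vec (c : Fin 2 → ℝ) : momToComplex ![c 1, c 0] = I * (starRingEnd ℂ) (momToComplex c) := by
  apply Complex.ext <;> simp

include hpi in
/-- Value at the polar angle of `−c`. -/
theorem profile_polarAngle_neg (c : Fin 2 → ℝ) : f (polarAngle (-c)) = f (polarAngle c) := by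
  by_cases hc : c = 0
  · subst hc; rw [neg_zero]
  have hz : momToComplex c ≠ 0 := fun h => hc ((momToComplex_eq_zero_iff c).1 h)
  have h : ((polarAngle (-c) : ℝ) : Real.Angle) = ((polarAngle c + π : ℝ) : Real.Angle) := by
    rw [polarAngle, polarAngle, momToComplex_neg_vec, Complex.arg_neg_coe_angle hz, Real.Angle.coe_add]
  rw [profile_eq_of_coe_angle_eq hper h, hpi]

include hneg in
/-- Value at the polar angle of `(c₀, −c₁)`. -/
theorem profile_polarAngle_reflect (c : Fin 2 → ℝ) : f (polarAngle ![c 0, -c 1]) = f (polarAngle c) := by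
  have h : ((polarAngle ![c 0, -c 1] : ℝ) : Real.Angle) = ((-polarAngle c : ℝ) : Real.Angle) := by
    rw [polarAngle, polarAngle, momToComplex_reflect_vec, Complex.arg_conj_coe_angle, Real.Angle.coe_neg]
  rw [profile_eq_of_coe_angle_eq hper h, hneg]

include hpi hneg in
/-- Value at the polar angle of `(−c₀, c₁)`. -/
theorem profile_polarAngle_negReflect (c : Fin 2 → ℝ) : f (polarAngle ![-c 0, c 1]) = f (polarAngle c) := by
  by_cases hc : c = 0
  · subst hc
    have : (![-(0 : Fin 2 → ℝ) 0, (0 : Fin 2 → ℝ) 1] : Fin 2 → ℝ) = 0 := by ext i; fin_cases i <;> simp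
    rw [this]
  have hz : momToComplex c ≠ 0 := fun h => hc ((momToComplex_eq_zero_iff c).1 h)
  have hz' : (starRingEnd ℂ) (momToComplex c) ≠ 0 := by
    rwa [Ne, map_eq_zero]
  have h : ((polarAngle ![-c 0, c 1] : ℝ) : Real.Angle) = ((-polarAngle c + π : ℝ) : Real.Angle) := by
    rw [polarAngle, polarAngle, momToComplex_negReflect_vec, Complex.arg_neg_coe_angle hz', Complex.arg_conj_coe_angle,
      Real.Angle.coe_add, Real.Angle.coe_neg]
  rw [profile_eq_of_coe_angle_eq hper h, hpi, hneg]

include hsw in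
/-- Value at the polar angle of `(c₁, c₀)`. -/
theorem profile_polarAngle_swap (c : Fin 2 → ℝ) : f (polarAngle ![c 1, c 0]) = f (polarAngle c) := by
  by_cases hc : c = 0
  · subst hc
    have : (![(0 : Fin 2 → ℝ) 1, (0 : Fin 2 → ℝ) 0] : Fin 2 → ℝ) = 0 := by ext i; fin_cases i <;> simp
    rw [this]
  have hz : momToComplex c ≠ 0 := fun h => hc ((momToComplex_eq_zero_iff c).1 h)
  have hz' : (starRingEnd ℂ) (momToComplex c) ≠ 0 := by
    rwa [Ne, map_eq_zero]
  have h : ((polarAngle ![c 1, c 0] : ℝ) : Real.Angle) = ((π / 2 - polarAngle c : ℝ) : Real.Angle) := by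
    rw [polarAngle, polarAngle, momToComplex_swap_vec, Complex.arg_mul_coe_angle Complex.I_ne_zero hz', Complex.arg_I,
      Complex.arg_conj_coe_angle, Real.Angle.coe_sub, sub_eq_add_neg]
  rw [profile_eq_of_coe_angle_eq hper h, hsw]

end Profile

/-! ## Appendix — the quarter turn `θ ↦ θ + π/2` (the hypothesis shape `hquart` of `…CountertermFrameExtGData/Wiggle`) -/

section Quarter

variable {L M : ℕ} [NeZero L] [NeZero M]

/-- `ν_n(K)(θ + π/2) = ν_n(K)(θ)` — the quarter turn, from `θ ↦ π/2 − θ` composed with `θ ↦ −θ`. -/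
theorem klLocalPart_add_pi_div_two (β U μ : ℝ) (K : TrigPolyC4v) (n : ℕ) (θ : ℝ) :
    klLocalPart L M β U μ K n (θ + π / 2) = klLocalPart L M β U μ K n θ := by
  rw [show θ + π / 2 = π / 2 - (-θ) by ring, klLocalPart_pi_div_two_sub, klLocalPart_neg]

end Quarter

/-- `K(k_F(θ + π/2)) = K(k_F(θ))` — the quarter turn for the frame read on its own curve. -/
theorem frameOnCurve_add_pi_div_two (μ : ℝ) (K : TrigPolyC4v) (θ : ℝ) :
    K.eval (klFermiPoint μ K (θ + π / 2)) = K.eval (klFermiPoint μ K θ) := by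
  rw [show θ + π / 2 = π / 2 - (-θ) by ring, frameOnCurve_pi_div_two_sub, frameOnCurve_neg]

end Summit.HubbardSuperconductivity.HubbardSuperconductivity.Theorems.KLRegimeSplit

end
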